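import Summits.AnomalousDissipation.AnomalousDissipation.Theorems.SolenoidalFractalHomogenisationLagrangianStepEffectiveFrameEnergyLDissipation
import Summits.AnomalousDissipation.AnomalousDissipation.Theorems.SolenoidalFractalHomogenisationLagrangianStepBandKillCore
import Summits.AnomalousDissipation.AnomalousDissipation.Theorems.SolenoidalFractalHomogenisationLagrangianCarrierAnalyticTower
import Literature.Analysis.FluidPDE.PassiveVectorTensorLowModeCapture
import HarnessLib

/-!
# W3-E (ii) `stub_effectiveFrameEnergyL_bandKill`: the SHORT-SEPARATION branch (`L < 2000`) — band kill from the dissipation floor and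
# low-mode capture (helper for K1L_D `stmt-AnomalousDissipation-27980`)

Summits-side helper file (everything proved; no definitions, no named facts).  Under the v31 binders of the stub, for frequency levels
`2L' ≤ L < 2000` and any leak constants `C₂ ≥ 10⁵`, `c₃`, the two band-kill clauses hold for `T ∈ {Um s s′, (Um s s′)†}`:
(ii-in) from clause (i) (`effectiveFrameEnergyL_dissipation`, p681732) through `OneLevelSplit.norm_apply_le_of_floor` — the leak
`e^{−(L−L')/(C₂N_m)} ≥ e^{−2000/C₂} ≥ 3/4` absorbs the half-floor; (ii-out) through `OneLevelSplit.norm_sub_cutLp_apply_le_of_floor_of_capture`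
with the capture bound of `PassiveVectorTensorLowModeCapture` for the adjoint (`ε = 12π L' · sup|b_{≤m}| · (s′−s) ≤ 1/5` under the strain
ceiling, `sup|b_{≤m}| ≤ C_b Σ a_{i+1}/N_{i+1}` from the analytic tower at order zero).  This is the branch of the assembly where no cube ladder
fits between the balls `L'` and `L`. Infrastructure for route-1's rung leaf F-D1.A0 (a frontier FORMAL rung); NOT a proof of anomalous
dissipation.
-/

set_option linter.dupNamespace false

namespace Summit.AnomalousDissipation.AnomalousDissipation.Theorems.SolenoidalFractalHomogenisation.LagrangianStep

open Literature.Analysis Literature.Analysis.FluidPDE Literature.Analysis.FunctionSpaces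
open MeasureTheory Set Filter Function
open scoped ENNReal NNReal InnerProductSpace
open Literature.Analysis.FluidPDE.LatticeShear
open Summit.AnomalousDissipation.AnomalousDissipation.Theorems.SolenoidalFractalHomogenisation.LagrangianRenormalisationStep
  (memLp_top_stLift_of_continuous continuous_uncurry_partialSum isWeaklyDivFree_partialSum)
open Summit.AnomalousDissipation.AnomalousDissipation.Theorems.SolenoidalFractalHomogenisation.LagrangianCarrierAnalytic
  (analytic_tower_vec)

noncomputable section

/-- Sup bound of the coarse field from the analytic tower at order zero: `‖b_{≤m}(t,x)‖ ≤ C_b Σ_{i<m} a_{i+1}/N_{i+1}`. -/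
theorem norm_partialSum_le_of_tower {k : ℕ} (E : LagrangianLatticeCarrier k) (hR : E.LevelRegular) {ρs Cb : ℝ}
    (h : ∀ (i : ℕ) (t : ℝ) (n : ℕ), Torus.dnorm n (ρs * E.N (i + 1)) (E.b (i + 1) t) ≤ Cb * (E.a (i + 1) / E.N (i + 1)))
    (m : ℕ) (t : ℝ) (x : UnitAddTorus (Fin 3)) :
    ‖E.partialSum m t x‖ ≤ Cb * ∑ i ∈ Finset.range m, E.a (i + 1) / E.N (i + 1) := by
  unfold LagrangianLatticeCarrier.partialSum
  rw [Finset.mul_sum]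
  refine (norm_sum_le _ _).trans (Finset.sum_le_sum fun i _ => ?_)
  exact (Torus.norm_le_dnorm_zero (R := ρs * E.N (i + 1)) (hR.isSmooth_b i t) x).trans (h i t 0)

/-- `Σ_{i<m} a_{i+1}(s′−s)/N_{i+1} ≤ 2θ_{m+1}` on a window of length `≤ 2·refresh(m+1)` (strain clause, `N_{i+1} ≥ 1`). -/
theorem sum_a_div_N_mul_le {k : ℕ} (E : LagrangianLatticeCarrier k) (hLP : E.LPermissible) (m : ℕ) {s s' : ℝ} (hss' : s ≤ s')
    (hlen : s' - s ≤ 2 * E.refresh (m + 1)) :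
    (∑ i ∈ Finset.range m, E.a (i + 1) / E.N (i + 1)) * (s' - s) ≤ 2 * E.θ (m + 1) := by
  have hstrain := hLP.strain_le m
  unfold LagrangianLatticeCarrier.strain at hstrain
  have h1 : ∑ i ∈ Finset.range m, E.a (i + 1) / E.N (i + 1) ≤ ∑ i ∈ Finset.range m, E.a (i + 1) :=
    Finset.sum_le_sum fun i _ => by
      have hN : (1 : ℝ) ≤ E.N (i + 1) := by exact_mod_cast E.N_pos (i + 1)
      exact div_le_self (E.a_pos _).le hN
  have hS0 : 0 ≤ ∑ i ∈ Finset.range m, E.a (i + 1) := Finset.sum_nonneg fun i _ => (E.a_pos _).le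
  calc (∑ i ∈ Finset.range m, E.a (i + 1) / E.N (i + 1)) * (s' - s) ≤ (∑ i ∈ Finset.range m, E.a (i + 1)) * (2 * E.refresh (m + 1)) :=
        mul_le_mul h1 hlen (by linarith) hS0
    _ = 2 * ((∑ i ∈ Finset.range m, E.a (i + 1)) * E.refresh (m + 1)) := by ring
    _ ≤ 2 * E.θ (m + 1) := by linarith

/-- **W3-E (ii), SHORT-SEPARATION BRANCH** (see the module docstring): the two band-kill clauses for `2L' ≤ L`, `L < 2000`, any `C₂ ≥ 10⁵` and
any `c₃`, under the v31 binders and the strain ceiling `θ₁` of this file. -/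
theorem bandKill_smallL : ∀ k (W : Literature.Analysis.FluidPDE.LatticeShear.LatticeWord k) (M : ℝ) (hM : 0 < M)
    (c : ℝ), 0 < c →
    ∀ (Φ : ℝ → Torus.Visc4 (Fin 3) → Torus.Visc4 (Fin 3)) (lo hi β : ℝ), 0 < lo → lo ≤ 1 → 1 ≤ hi → 0 ≤ β →
      ∃ θ₁ > (0:ℝ),
        ∀ E : Literature.Analysis.FluidPDE.LatticeShear.LagrangianLatticeCarrier k, E.design = W.stretch M hM → E.gain = c →
          E.LPermissible → E.Regular → (∀ i, E.θ (i + 1) ≤ θ₁) → (∀ m, E.N m ^ 2 ≤ E.N (m + 1)) →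
        ∀ (m : ℕ),
        ∀ (S : Torus.Visc4 (Fin 3)), Torus.OddSmall S β → Torus.NearIso S lo hi →
          Torus.OddSmall (Φ (E.cellVisc (m + 1)) S) β → Torus.NearIso (Φ (E.cellVisc (m + 1)) S) lo hi →
        ∀ Um : ℝ → ℝ → (V2 →L[ℝ] V2),
          Torus.IsPropagator 1 (E.partialSum m) (E.kbar m • renormStep (Φ (E.cellVisc (m + 1))) (E.gain / E.cellVisc (m + 1) ^ 2) S) Um →
        ∀ (s s' : ℝ), 0 ≤ s → s ≤ s' → s' ≤ 1 → s' - s ≤ 2 * E.refresh (m + 1) →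
        ∀ T : V2 →L[ℝ] V2, (T = Um s s' ∨ T = ContinuousLinearMap.adjoint (Um s s')) →
        ∀ (C₂ c₃ : ℝ), 100000 ≤ C₂ →
        ∀ L' L : ℕ, 2 * L' ≤ L → L < 2000 →
          (∀ y : V2,
              ‖T y - cutLp L (T y)‖
                ≤ Real.exp (-(E.a (m + 1) * (8 * Real.pi ^ 2 * (L' : ℝ) ^ 2 * lo * (E.cellVisc (m + 1) + c / E.cellVisc (m + 1))
                    / (E.N (m + 1) : ℝ) ^ 2) * (s' - s) / 2)) * ‖y - cutLp L' y‖
                  + (Real.exp (-(c₃ / E.θ (m + 1))) + Real.exp (-(((L : ℝ) - L') / (C₂ * E.N m)))) * ‖y‖) ∧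
          (∀ y : V2, cutLp L y = 0 →
              ‖T y‖
                ≤ (Real.exp (-(E.a (m + 1) * (8 * Real.pi ^ 2 * (L' : ℝ) ^ 2 * lo * (E.cellVisc (m + 1) + c / E.cellVisc (m + 1))
                    / (E.N (m + 1) : ℝ) ^ 2) * (s' - s) / 2))
                  + (Real.exp (-(c₃ / E.θ (m + 1))) + Real.exp (-(((L : ℝ) - L') / (C₂ * E.N m))))) * ‖y‖) := by
  intro k W M hM c hc Φ lo hi β hlo hlo1 hhi hβ
  obtain ⟨θa, hθa, hA⟩ := effectiveFrameEnergyL_dissipation k W M hM c hc Φ lo hi β hlo hlo1 hhi hβ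
  obtain ⟨ρs, _, Cb, hCb, θH, hθH, hTow⟩ := analytic_tower_vec k W M hM
  -- the ceiling: clause (i), the tower, and the capture size `12π · 1000 · Cb · 2θ ≤ 1/5`
  refine ⟨min (min θa θH) (1 / (120000 * Real.pi * Cb + 1)), lt_min (lt_min hθa hθH) (by positivity), ?_⟩
  intro E hdes hgain hLP hReg hθ hsq m S hS₁ hS₂ hS₃ hS₄ Um hUm s s' hs hss' hs'1 hlen T hT C₂ c₃ hC₂ L' L hL hLsmall
  have hP := hLP.permissible
  have hLR := hReg.levelRegular
  have hθa' : ∀ i, E.θ (i + 1) ≤ θa := fun i => (hθ i).trans ((min_le_left _ _).trans (min_le_left _ _))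
  have hθH' : ∀ i, E.θ (i + 1) ≤ θH := fun i => (hθ i).trans ((min_le_left _ _).trans (min_le_right _ _))
  have hθc : E.θ (m + 1) ≤ 1 / (120000 * Real.pi * Cb + 1) := (hθ m).trans (min_le_right _ _)
  have hfloor := hA E hdes hgain hLP hReg hθa' hsq m S hS₁ hS₂ hS₃ hS₄ Um hUm s s' hs hss' hs'1 hlen
  have htower := hTow E hdes hLP hReg hθH' hsq
  -- the rate `κ` and the two currencies
  obtain ⟨κ, hκ⟩ : ∃ κ : ℝ, κ = E.a (m + 1) * (8 * Real.pi ^ 2 * lo * (E.cellVisc (m + 1) + c / E.cellVisc (m + 1))) /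
      (E.N (m + 1) : ℝ) ^ 2 * (s' - s) := ⟨_, rfl⟩
  have hν : 0 < E.cellVisc (m + 1) := by
    unfold FractalCarrierData.cellVisc
    exact div_pos (mul_pos (E.kbar_pos _) (by have := E.N_pos (m + 1); positivity)) (E.a_pos _)
  have hκ0 : 0 ≤ κ := by
    have := E.a_pos (m + 1)
    have : 0 < E.cellVisc (m + 1) + c / E.cellVisc (m + 1) := by positivity
    rw [hκ]; exact mul_nonneg (div_nonneg (by positivity) (by positivity)) (by linarith)
  have hrate : ∀ k' : Fin 3 → ℤ, E.a (m + 1) * (8 * Real.pi ^ 2 * ‖Torus.latticeVec k'‖ ^ 2 * lo *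
      (E.cellVisc (m + 1) + c / E.cellVisc (m + 1)) / (E.N (m + 1) : ℝ) ^ 2) * (s' - s) = κ * ‖Torus.latticeVec k'‖ ^ 2 := by
    intro k'; rw [hκ]; ring
  have hexp : Real.exp (-(E.a (m + 1) * (8 * Real.pi ^ 2 * (L' : ℝ) ^ 2 * lo * (E.cellVisc (m + 1) + c / E.cellVisc (m + 1))
      / (E.N (m + 1) : ℝ) ^ 2) * (s' - s) / 2)) = Real.exp (-(κ * (L' : ℝ) ^ 2 / 2)) := by
    congr 1; rw [hκ]; ring
  -- clause (i) in the `κ` currency, for `T'` equal to `Um s s'` or its adjoint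
  have hfl : ∀ T' : V2 →L[ℝ] V2, (T' = Um s s' ∨ T' = ContinuousLinearMap.adjoint (Um s s')) → ∀ y : V2,
      ‖T' y‖ ^ 2 ≤ ‖y‖ ^ 2 - 1 / 2 * ∑' k' : Fin 3 → ℤ, min 1 (κ * ‖Torus.latticeVec k'‖ ^ 2) *
        ‖UnitAddTorus.mFourierCoeff (EuclideanSpace.complexify ∘ (y : VF)) k'‖ ^ 2 := by
    intro T' hT' y
    have h := hfloor T' hT' y
    have e : ∑' k' : Fin 3 → ℤ, min 1 (E.a (m + 1) * (8 * Real.pi ^ 2 * ‖Torus.latticeVec k'‖ ^ 2 * lo *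
        (E.cellVisc (m + 1) + c / E.cellVisc (m + 1)) / (E.N (m + 1) : ℝ) ^ 2) * (s' - s)) *
        ‖UnitAddTorus.mFourierCoeff (EuclideanSpace.complexify ∘ ⇑y) k'‖ ^ 2 =
        ∑' k' : Fin 3 → ℤ, min 1 (κ * ‖Torus.latticeVec k'‖ ^ 2) * ‖UnitAddTorus.mFourierCoeff (EuclideanSpace.complexify ∘ (y : VF)) k'‖ ^ 2 :=
      tsum_congr fun k' => by rw [hrate k']
    rw [e] at h; exact h
  -- the leak is at least `3/4 + 1/5`
  obtain ⟨ℓ, hℓ⟩ : ∃ ℓ : ℝ, ℓ = Real.exp (-(c₃ / E.θ (m + 1))) + Real.exp (-(((L : ℝ) - L') / (C₂ * E.N m))) := ⟨_, rfl⟩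
  rw [← hℓ]
  have hNm : (1 : ℝ) ≤ E.N m := by exact_mod_cast E.N_pos m
  have hℓ2 : Real.exp (-(1 / 50 : ℝ)) ≤ Real.exp (-(((L : ℝ) - L') / (C₂ * E.N m))) := by
    refine Real.exp_le_exp.2 (neg_le_neg ?_)
    have hL' : ((L : ℝ) - L') ≤ 2000 := by
      have : (L : ℝ) < 2000 := by exact_mod_cast hLsmall
      linarith [(Nat.cast_nonneg L' : (0:ℝ) ≤ L')]
    have hden : (100000 : ℝ) ≤ C₂ * E.N m := by nlinarith
    calc ((L : ℝ) - L') / (C₂ * E.N m) ≤ 2000 / (C₂ * E.N m) := div_le_div_of_nonneg_right hL' (by positivity)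
      _ ≤ 2000 / 100000 := div_le_div_of_nonneg_left (by norm_num) (by norm_num) hden
      _ = 1 / 50 := by norm_num
  have he50 : (19 / 20 : ℝ) ≤ Real.exp (-(1 / 50 : ℝ)) := by
    have := Real.add_one_le_exp (-(1 / 50 : ℝ)); linarith
  have hℓge : 3 / 4 + 1 / 5 ≤ ℓ := by
    have h1 : 0 ≤ Real.exp (-(c₃ / E.θ (m + 1))) := Real.exp_nonneg _
    rw [hℓ]; linarith
  -- common carrier facts
  have hcont : Continuous (uncurry (E.partialSum m)) := continuous_uncurry_partialSum E m fun i _ => hLR.continuous_uncurry_b i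
  have hb := memLp_top_stLift_of_continuous hcont 1
  have hbdiv : ∀ᵐ τ ∂(volume.restrict (Ioo (0:ℝ) 1)), Torus.IsWeaklyDivFree (E.partialSum m τ) :=
    ae_of_all _ fun τ => isWeaklyDivFree_partialSum E m (fun i _ => hLR.continuous_uncurry_b i) (fun i _ t => hLR.isWeaklyDivFree_b i t) τ
  have hbc : ∀ᵐ τ ∂(volume.restrict (Ioo (0:ℝ) 1)), Continuous (E.partialSum m τ) :=
    ae_of_all _ fun τ => hcont.comp (Continuous.prodMk_right τ)
  obtain ⟨B, hB⟩ : ∃ B : ℝ, B = Cb * ∑ i ∈ Finset.range m, E.a (i + 1) / E.N (i + 1) := ⟨_, rfl⟩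
  have hB0 : 0 ≤ B := by rw [hB]; exact mul_nonneg hCb.le (Finset.sum_nonneg fun i _ => by have := E.a_pos (i + 1); positivity)
  have hBall : ∀ᵐ τ ∂(volume.restrict (Ioo (0:ℝ) 1)), ∀ x, ‖E.partialSum m τ x‖ ≤ B :=
    ae_of_all _ fun τ x => hB ▸ norm_partialSum_le_of_tower E hLR htower m τ x
  have hg0 : 0 ≤ E.gain / E.cellVisc (m + 1) ^ 2 := div_nonneg (hgain ▸ hc.le) (sq_nonneg _)
  have h𝔸 : Torus.NearIso (E.kbar m • renormStep (Φ (E.cellVisc (m + 1))) (E.gain / E.cellVisc (m + 1) ^ 2) S)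
      (E.kbar m * lo) (E.kbar m * hi) := (nearIso_renormStep hg0 hS₂ hS₄).smul (E.kbar_pos m).le
  have hklo : 0 < E.kbar m * lo := mul_pos (E.kbar_pos m) hlo
  -- the capture size
  have hεcap : 4 * Real.pi * (Fintype.card (Fin 3) : ℝ) * L' * B * (s' - s) ≤ 1 / 5 := by
    rw [Fintype.card_fin]
    have hL'1000 : (L' : ℝ) ≤ 1000 := by
      have : (2 * L' : ℝ) ≤ L := by exact_mod_cast hL
      have : (L : ℝ) < 2000 := by exact_mod_cast hLsmall
      linarith
    have hBτ : B * (s' - s) ≤ Cb * (2 * E.θ (m + 1)) := by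
      rw [hB, mul_assoc]; exact mul_le_mul_of_nonneg_left (sum_a_div_N_mul_le E hLP m hss' hlen) hCb.le
    have hθC : E.θ (m + 1) * (120000 * Real.pi * Cb + 1) ≤ 1 := (le_div_iff₀ (by positivity)).1 hθc
    have hθ0 : 0 ≤ E.θ (m + 1) := (E.θ_pos _).le
    calc 4 * Real.pi * ((3 : ℕ) : ℝ) * L' * B * (s' - s) = 12 * Real.pi * L' * (B * (s' - s)) := by push_cast; ring
      _ ≤ 12 * Real.pi * 1000 * (Cb * (2 * E.θ (m + 1))) := by
          have h0 : 0 ≤ B * (s' - s) := mul_nonneg hB0 (by linarith)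
          have hπ : (0:ℝ) ≤ 12 * Real.pi := by positivity
          exact mul_le_mul (mul_le_mul_of_nonneg_left hL'1000 hπ) hBτ h0 (by positivity)
      _ = E.θ (m + 1) * (24000 * Real.pi * Cb) := by ring
      _ ≤ 1 / 5 := by nlinarith [Real.pi_pos]
  -- the adjoint of `T` is again one of the two maps
  have hT' : ContinuousLinearMap.adjoint T = Um s s' ∨ ContinuousLinearMap.adjoint T = ContinuousLinearMap.adjoint (Um s s') := by
    rcases hT with rfl | rfl
    · exact Or.inr rfl
    · exact Or.inl (ContinuousLinearMap.adjoint_adjoint _)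
  have hL'L : L' ≤ L := by omega
  -- ### the degenerate window `s = s'`: `T = T† = P_σ`, a modewise contraction
  rcases hss'.eq_or_lt with hEq | hlt
  · subst hEq
    have hκz : κ = 0 := by rw [hκ, sub_self, mul_zero]
    have hTy : ∀ y : V2, ‖T y‖ ≤ ‖y‖ := fun y => by
      rcases hT with rfl | rfl
      · exact hUm.norm_le s s y
      · exact norm_adjoint_apply_le_of_norm_le (fun y => hUm.norm_le s s y) y
    have hℓ1 : 0 ≤ ℓ := by positivity
    have hUP : Um s s = (Torus.divFreeL2 (Fin 3)).starProjection := by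
      ext1 y; rw [hUm.apply_eq_apply_starProjection s s y]
      exact hUm.self_of_divFree s hs hs'1 _ (Torus.isWeaklyDivFree_starProjection y)
    have hTadj : ContinuousLinearMap.adjoint T = (Torus.divFreeL2 (Fin 3)).starProjection := by
      rcases hT with rfl | rfl
      · rw [hUP]; exact (isSelfAdjoint_starProjection _).adjoint_eq
      · rw [ContinuousLinearMap.adjoint_adjoint, hUP]
    refine ⟨fun y => ?_, fun y _ => ?_⟩
    · have h1 : ∀ z : V2, (∀ k' ∈ Torus.freqBall L, UnitAddTorus.mFourierCoeff (EuclideanSpace.complexify ∘ (z : VF)) k' = 0) →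
          ‖ContinuousLinearMap.adjoint T z‖ ≤ 1 * ‖z‖ := fun z _ => by
        rw [hTadj, ← hUP, one_mul]; exact hUm.norm_le s s z
      have h2 : ∀ z : V2, (∀ k' ∈ Torus.freqBall L, UnitAddTorus.mFourierCoeff (EuclideanSpace.complexify ∘ (z : VF)) k' = 0) →
          ‖cutLp L' (ContinuousLinearMap.adjoint T z)‖ ≤ 0 * ‖z‖ := fun z hz => by
        rw [hTadj]
        refine OneLevelSplit.norm_cutLp_le_of_sum_le le_rfl (le_of_eq_of_le (Finset.sum_eq_zero fun k' hk' => ?_) (by positivity))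
        have h0 := hz k' (Torus.freqBall_mono hL'L hk')
        have hle := Torus.norm_mFourierCoeff_starProjection_le z k'
        rw [h0, norm_zero] at hle
        rw [norm_le_zero_iff.1 hle, norm_zero, zero_pow two_ne_zero]
      have h := OneLevelSplit.norm_sub_cutLp_apply_le_of_adjoint_bounds T zero_le_one le_rfl h1 h2 y
      rw [one_mul, zero_mul, add_zero] at h
      rw [hexp, hκz, zero_mul, zero_div, neg_zero, Real.exp_zero, one_mul]
      exact h.trans (le_add_of_nonneg_right (mul_nonneg hℓ1 (norm_nonneg y)))
    · rw [hexp, hκz, zero_mul, zero_div, neg_zero, Real.exp_zero]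
      exact (hTy y).trans (le_mul_of_one_le_left (norm_nonneg y) (by linarith))
  -- ### a genuine window `s < s'`
  · have hτ0 : 0 ≤ s' - s := by linarith
    have hε0 : 0 ≤ 4 * Real.pi * (Fintype.card (Fin 3) : ℝ) * L' * B * (s' - s) := by positivity
    have hℓ34 : 3 / 4 ≤ ℓ := by linarith
    have hcapT : ∀ z : V2, (∀ k' ∈ Torus.freqBall L, UnitAddTorus.mFourierCoeff (EuclideanSpace.complexify ∘ (z : VF)) k' = 0) →
        ‖cutLp L' (ContinuousLinearMap.adjoint T z)‖ ≤ (4 * Real.pi * (Fintype.card (Fin 3) : ℝ) * L' * B * (s' - s)) * ‖z‖ := by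
      intro z hz
      have hz' : ∀ k' ∈ Torus.freqBall L', UnitAddTorus.mFourierCoeff (EuclideanSpace.complexify ∘ (z : VF)) k' = 0 :=
        fun k' hk' => hz k' (Torus.freqBall_mono hL'L hk')
      refine OneLevelSplit.norm_cutLp_le_of_sum_le hε0 ?_
      rcases hT with rfl | rfl
      · exact hUm.lowModeCapture_adjoint h𝔸 hklo hb hbdiv hbc hB0 hBall hs hlt hs'1 L' z hz'
      · rw [ContinuousLinearMap.adjoint_adjoint]; exact hUm.lowModeCapture h𝔸 hklo hb hbdiv hbc hB0 hBall hs hlt hs'1 L' z hz'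
    refine ⟨fun y => ?_, fun y hy => ?_⟩
    · rw [hexp]
      exact OneLevelSplit.norm_sub_cutLp_apply_le_of_floor_of_capture T hκ0 (hfl _ hT') hL hε0 (by linarith) hcapT y
    · rw [hexp]
      exact OneLevelSplit.norm_apply_le_of_floor T hκ0 (hfl T hT) hL hℓ34 y (OneLevelSplit.mFourierCoeff_eq_zero_of_cutLp_eq_zero hy)

end

end Summit.AnomalousDissipation.AnomalousDissipation.Theorems.SolenoidalFractalHomogenisation.LagrangianStep
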